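import Mathlib.Tactic
import HarnessLib
import HarnessLib.Audit.Tags
import Summits.CriticalPhenomena.PercolationContinuityZ3.Theorems.PercNearOneGluingNoHeavyLowerTailSahiColouredDaykinBrualdi

/-!
# `LFCrude` is false on `Fin 8` — the "crude" form of the leak-free conjecture dies under adversarial search

Support file (seat `prim-masterthm-p1`, gen 32; `--supports stmt-CriticalPhenomena-4575`).  One kernel refutation; no `sorry`, standard axioms.  Memo
`run/shared/lean/prim/prim-masterthm/FROM-prim-masterthm-p1-g32-TYPED-BRUALDI.md` §7.

`LFCrude` (`…SahiColouredDaykinBrualdi`, filed earlier the same session) asked, for every crossing three-colour configuration with all colours present, for an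
inclusion-minimal admissible intersection `E` that is not `Dangerous` (no rainbow triple `(p,q,w)` with `q ∪ w = (F \ p) ∪ E` or `q ∩ w = (F \ p) \ E`).  It held on
every configuration of `2^5`, on ≈ 9 000 random / imbalanced / product-structured configurations of `2^6`–`2^{10}` and on the block families — and a prescribed-size
simulated annealing (`code-g32/lf_anneal.py`) refuted it within a minute: the configuration below (class sizes `(7,4,2)` on 8 points, found in dimension 8) is crossing,
its inclusion-minimal admissible intersections are exactly the eight singletons, and every singleton is dangerous (explicit rainbow triples, checked by `decide`).
WHAT DIES WITH IT: the finer, Brualdi-set-aware form "some inclusion-minimal `E` has ALL candidates outside `admDiffs (P \ brualdiSet E)`" also fails under the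
same annealing (e.g. `{0146,3456,0134,0245 | 1234,135,1245,156 | 126,236}` on 7 points: every minimal `E` has exactly one leaking candidate; memo §7).  WHAT SURVIVES
(all annealed counterexamples, all censuses): for every inclusion-minimal `E` there, `#admDiffs P − #admDiffs (P \ brualdiSet E) ≥ #brualdiSet E` still holds with
large margin (the leaking candidate is compensated by other lost elements) — the multi-member deletion step itself is intact, only its naive private set is not; and
the unconditional corollary `card_le_card_compatJoins_of_threeWise` is unaffected.  HONEST FRAMING: a refutation of this seat's own typed conjecture, filed two
hours after it; the lesson of gen 31 (test prescribed-size ADVERSARIAL search before typing) applied one conjecture too late. [this work]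
-/

namespace Summit.CriticalPhenomena.PercolationContinuityZ3.Theorems.SahiColouredDaykin

open Finset

/-- The annealer's configuration on `Fin 8`: colour 0 = `{1257, 01257, 1357, 0127, 1234, 2367, 2347}`, colour 1 = `{037, 0236, 0456, 1267}`, colour 2 = `{0146, 0356}`. [this work] -/
def lfCexP : Finset (Finset (Fin 8)) :=
  {{1,2,5,7}, {0,1,2,5,7}, {1,3,5,7}, {0,1,2,7}, {1,2,3,4}, {2,3,6,7}, {2,3,4,7}, {0,3,7}, {0,2,3,6}, {0,4,5,6}, {1,2,6,7}, {0,1,4,6}, {0,3,5,6}}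

/-- Its colouring. [this work] -/
def lfCexC (S : Finset (Fin 8)) : Fin 3 :=
  if S = {0,3,7} ∨ S = {0,2,3,6} ∨ S = {0,4,5,6} ∨ S = {1,2,6,7} then 1
  else if S = {0,1,4,6} ∨ S = {0,3,5,6} then 2 else 0

set_option maxRecDepth 32768 in
/-- Every singleton is an admissible intersection of the configuration. [this work] -/
private theorem singleton_mem_admInters_lfCex : ∀ i : Fin 8, ({i} : Finset (Fin 8)) ∈ admInters univ lfCexP lfCexC := by
  unfold admInters samePairs crossPairs lfCexP lfCexC; decide

set_option maxRecDepth 32768 in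
/-- Every singleton is dangerous (explicit rainbow triples). [this work] -/
private theorem dangerous_singleton_lfCex : ∀ i : Fin 8, Dangerous univ lfCexP lfCexC {i} := by
  unfold Dangerous lfCexP lfCexC; decide

set_option maxRecDepth 32768 in
/-- **`LFCrude` fails on `Fin 8`.** [this work] -/
theorem not_lfCrude_fin8 : ¬ LFCrude (Fin 8) := by
  intro h
  have h1 : ∀ S ∈ lfCexP, S ⊆ (univ : Finset (Fin 8)) := fun S _ => subset_univ S
  have h2 : ∀ S ∈ lfCexP, ∀ T ∈ lfCexP, lfCexC S ≠ lfCexC T → ¬ S ⊆ T := by unfold lfCexP lfCexC; decide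
  have h3 : ∀ S ∈ lfCexP, ∀ T ∈ lfCexP, (S ∩ T).Nonempty ∧ S ∪ T ≠ (univ : Finset (Fin 8)) := by unfold lfCexP; decide
  have h4 : ∀ i : Fin 3, ∃ p ∈ lfCexP, lfCexC p = i := by unfold lfCexP lfCexC; decide
  obtain ⟨E, hEI, hmin, hnd⟩ := h univ lfCexP lfCexC h1 h2 h3 h4
  have hcross : IsCrossing univ lfCexP lfCexC := ⟨h1, h2, h3⟩
  obtain ⟨x, hx⟩ := nonempty_of_mem_admInters hcross hEI
  have hE : ({x} : Finset (Fin 8)) = E := hmin {x} (singleton_mem_admInters_lfCex x) (singleton_subset_iff.2 hx)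
  exact hnd (hE ▸ dangerous_singleton_lfCex x)

end Summit.CriticalPhenomena.PercolationContinuityZ3.Theorems.SahiColouredDaykin
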